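import Summits.KontsevichZagierPeriods.KontsevichZagierPeriods.Theorems.SoloInformedZetaTwo
import Summits.KontsevichZagierPeriods.KontsevichZagierPeriods.Theorems.SoloInformedBakerRing
import Summits.KontsevichZagierPeriods.KontsevichZagierPeriods.Theorems.SoloInformedKZExamplePi
import Summits.KontsevichZagierPeriods.KontsevichZagierPeriods.Theorems.SoloInformedTorusInstance
import HarnessLib
import HarnessLib.Audit

/-!
# SoloInformed — `π`, `π²`, `ζ(2)` and the solid torus in the Baker ring; [KZ01, §1.1] with the disc

Solo programme `solo-KontsevichZagierPeriods-informed`, session s209 (file 564).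

The Baker ring `soloInformedBakerRing ⊆ P = FormalRep ⧸ relations` (`SoloInformedBakerRing`) is the
subring of the formal period ring generated by the classes of points `[pt, a]` and of the
one-variable rational integrals; the period conjecture holds on it under the conjecture
`AlgIndepLogarithms` on algebraic independence of logarithms of algebraic numbers
(`soloInformed_injOn_evalP_bakerRing`), and UNCONDITIONALLY on the Baker group
(`soloInformed_bakerGroup_eq_of_evalP_eq`, Baker's theorem).  This file places four classical
higher-dimensional representations inside it, using identities already proved INSIDE the
four-move calculus by earlier files of the programme:

* `π`: `[D̄, 1] ∼ 4·[[0,1], 1/(1+t²)]` (`SoloInformedPiDisc`) puts the class of the DISC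
  `KZ.piRep` (dimension `2`) in the Baker GROUP (`soloInformed_of_piRep_mem_segSpan`,
  `soloInformed_piRep_mem_bakerGroup`).  Consequences, unconditional (Baker's theorem on the
  span): every element of the span of points and segments with value `π` is congruent to `[D̄, 1]`
  (`soloInformed_sub_piRep_mem_relations_of_mem_segSpan`); in particular the disc is linked by the
  four moves to every one-variable rational integral with value `π` — `∫_{-∞}^{∞} dx/(1+x²)`,
  `∫₀¹ 4dx/(1+x²)`, … (`soloInformed_piRep_equivalent_of_isRational`, `…_of_isKRationalOne`) —
  and to the two algebraic representations `2∫_{-1}^{1} √(1−x²) dx`, `∫_{-1}^{1} dx/√(1−x²)` of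
  [Kontsevich–Zagier 2001, §1.1] (`soloInformed_kz01_piRep_equivalent`; the programme's
  `SoloInformedKZExamplePi` linked those two to each other).
* `π²` and the solid torus: `⟦[D̄ × D̄, 1]⟧ = ⟦π⟧²` and `⟦[T₀, 1]⟧ = ⟦π⟧²`
  (`SoloInformedTorusInstance`, Pappus in the calculus) lie in the Baker ring.
* `ζ(2)`: Euler's identity in the calculus, `6·[(0,1)², 1/(1−xy)] − [D̄]·[D̄] ∈ relations`
  (`SoloInformedZetaTwo`), and the scalar morphism `ρ : K →+* P` (`soloInformedPtHom`, to invert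
  `6`) give `⟦Z₂⟧ = ρ(1/6)·⟦π⟧² ∈ soloInformedBakerRing` (`soloInformed_zetaTwoRep_mem_bakerRing`).
  Hence, under `AlgIndepLogarithms`, every formal combination with class in the Baker ring and
  value `π²/6` is congruent to Beukers' integral modulo the four moves
  (`soloInformed_sub_zetaTwoRep_mem_relations_of_mem_bakerRing`); e.g. a product
  `[D₁ × D₂, f(x) g(y)]` of one-variable rational integrals with value `π²/6` is `KZ.Equivalent`
  to `[(0,1)², 1/(1−xy)]` (`soloInformed_equivalent_prod_zetaTwoRep_of_isRational`).

This records as a KERNEL statement the corollary noted in the programme's verdict (s120): the one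
classical transcendence conjecture `AlgIndepLogarithms` decides the Kontsevich–Zagier conjecture
for all pairs drawn from the Baker ring, which now provably contains `⟦π⟧`, `⟦π²⟧`, `⟦ζ(2)⟧`.

References: M. Kontsevich, D. Zagier, *Periods* (2001), §1.1–§1.2; F. Beukers, E. Calabi,
J. Kolk, *Sums of generalized harmonic series and volumes* (1993); A. Baker, *Transcendental
Number Theory* (1975), Ch. 2.
-/

noncomputable section

open scoped BigOperators

namespace Summit.KontsevichZagierPeriods.KontsevichZagierPeriods.Theorems

open Set MvPolynomial
open Literature.NumberTheory.Transcendental Literature.NumberTheory.Transcendental.KZ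
open Literature.Barriers.Schanuel (AlgIndepLogarithms)

/-! ### `π`: the disc lies in the span of points and segments -/

/-- `[[0,1], 1/(1+t²)]` has rational data (`p = 1`, `q = 1 + X₀²`). -/
theorem soloInformed_arctanRep_isRational : soloInformedArctanRep.IsRational := by
  refine ⟨1, 1 + X 0 ^ 2, fun x _ => ?_, fun x _ => ?_⟩
  · simp only [map_add, map_one, map_pow, MvPolynomial.aeval_X]
    positivity
  · simp

/-- The class of the arctangent representation lies in the span of points and segments. -/
theorem soloInformed_of_arctanRep_mem_segSpan : of soloInformedArctanRep ∈ soloInformedSegSpan :=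
  soloInformed_of_mem_segSpan_of_isRational le_rfl _ soloInformed_arctanRep_isRational

/-- **The disc `[D̄, 1] = KZ.piRep` lies in the span of points and segments** (unconditionally):
`[D̄] = ([D̄] − 4·[arctan]) + 4·[arctan]`, a relation plus a rational one-variable integral.
[Kontsevich–Zagier 2001, §1.1–§1.2; this work] -/
theorem soloInformed_of_piRep_mem_segSpan : of piRep ∈ soloInformedSegSpan := by
  have h1 : of piRep - 4 • of soloInformedArctanRep ∈ soloInformedSegSpan :=
    soloInformed_relations_le_segSpan soloInformed_piRep_sub_four_nsmul_arctanRep_mem_relations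
  have h2 : 4 • of soloInformedArctanRep ∈ soloInformedSegSpan :=
    soloInformedSegSpan.nsmul_mem soloInformed_of_arctanRep_mem_segSpan 4
  have h := soloInformedSegSpan.add_mem h1 h2
  rwa [sub_add_cancel] at h

/-- `⟦[D̄, 1]⟧` lies in the Baker group. -/
theorem soloInformed_piRep_mem_bakerGroup :
    toFormalPeriod (of piRep) ∈ soloInformedBakerGroup :=
  soloInformed_toFormalPeriod_mem_bakerGroup soloInformed_of_piRep_mem_segSpan

/-- `⟦[D̄, 1]⟧` lies in the Baker ring. -/
theorem soloInformed_piRep_mem_bakerRing :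
    toFormalPeriod (of piRep) ∈ soloInformedBakerRing :=
  soloInformed_bakerGroup_le_bakerRing soloInformed_piRep_mem_bakerGroup

/-- **Every element of the span of points and segments with value `π` is congruent to the disc**
modulo the four moves (unconditional: Baker's theorem on the span). [this work] -/
theorem soloInformed_sub_piRep_mem_relations_of_mem_segSpan {x : FormalRep}
    (hx : x ∈ soloInformedSegSpan) (h : eval x = Real.pi) : x - of piRep ∈ relations :=
  soloInformed_mem_relations_of_mem_segSpan
    (soloInformedSegSpan.sub_mem hx soloInformed_of_piRep_mem_segSpan)
    (by rw [map_sub, eval_of, piRep_value, h, sub_self])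

/-! ### [KZ01, §1.1] with the disc -/

/-- **The disc against one-variable rational integrals** (unconditional): every absolutely
convergent representation `[D, p(x)/q(x)]` of dimension `≤ 1` with `p, q ∈ ℚ[x]` and value `π` —
e.g. `∫_{-∞}^{∞} dx/(1+x²)`, `∫₀¹ 4 dx/(1+x²)` — is linked to `[D̄, 1]` by the four moves.
[Kontsevich–Zagier 2001, §1.1–§1.2; this work] -/
theorem soloInformed_piRep_equivalent_of_isRational {n : ℕ} (hn : n ≤ 1) (r : IntegralRep n)
    (hr : r.IsRational) (hv : r.value = Real.pi) : Equivalent piRep r :=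
  soloInformed_equivalent_of_mem_segSpan soloInformed_of_piRep_mem_segSpan
    (soloInformed_of_mem_segSpan_of_isRational hn r hr) (by rw [piRep_value, hv])

/-- The same for `K`-rational one-variable integrands (real algebraic coefficients,
`SoloInformedIsKRationalOne`) with value `π`. [this work] -/
theorem soloInformed_piRep_equivalent_of_isKRationalOne (r : IntegralRep 1)
    (hr : SoloInformedIsKRationalOne r) (hv : r.value = Real.pi) : Equivalent piRep r :=
  soloInformed_equivalent_of_mem_segSpan soloInformed_of_piRep_mem_segSpan
    (soloInformed_segSpan_of_isKRationalOne r hr) (by rw [piRep_value, hv])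

/-- **[Kontsevich–Zagier 2001, §1.1] decided, disc included** (unconditional): the disc
`∬_{x²+y²≤1} dx dy` (dimension `2`) is linked by the four moves to `2∫_{-1}^{1} √(1−x²) dx` and
to `∫_{-1}^{1} dx/√(1−x²)` (the two algebraic one-variable representations of
`SoloInformedKZExamplePi`, linked to each other by `soloInformed_kz_example_pi`).
[Kontsevich–Zagier 2001, §1.1–§1.2; this work] -/
theorem soloInformed_kz01_piRep_equivalent :
    Equivalent piRep soloInformedPiRepSqrt ∧ Equivalent piRep soloInformedPiRepInvSqrt :=
  ⟨soloInformed_equivalent_of_mem_segSpan soloInformed_of_piRep_mem_segSpan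
      soloInformed_piRep_mem_segSpan.1 (by rw [piRep_value, soloInformed_value_piRepSqrt]),
    soloInformed_equivalent_of_mem_segSpan soloInformed_of_piRep_mem_segSpan
      soloInformed_piRep_mem_segSpan.2 (by rw [piRep_value, soloInformed_value_piRepInvSqrt])⟩

/-! ### `π²`, the solid torus and `ζ(2)` in the Baker ring -/

/-- `⟦[D̄ × D̄, 1]⟧ = ⟦π⟧²` lies in the Baker ring. -/
theorem soloInformed_piSqRep_mem_bakerRing :
    toFormalPeriod (of soloInformedPiSqRep) ∈ soloInformedBakerRing :=
  soloInformed_prod_mem_bakerRing soloInformed_piRep_mem_bakerRing soloInformed_piRep_mem_bakerRing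

/-- `⟦[T₀, 1]⟧ = ⟦π⟧ · ⟦π⟧` in `P` (the solid torus, Pappus in the calculus). -/
theorem soloInformed_toFormalPeriod_torusRep :
    toFormalPeriod (of soloInformedTorusRep) =
      toFormalPeriod (of piRep) * toFormalPeriod (of piRep) := by
  rw [← map_mul, toFormalPeriod_eq_iff]
  exact soloInformed_torusRep_sub_piRep_mul_piRep_mem_relations

/-- The class of the solid torus `[T₀, 1]` lies in the Baker ring. -/
theorem soloInformed_torusRep_mem_bakerRing :
    toFormalPeriod (of soloInformedTorusRep) ∈ soloInformedBakerRing := by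
  rw [soloInformed_toFormalPeriod_torusRep]
  exact mul_mem soloInformed_piRep_mem_bakerRing soloInformed_piRep_mem_bakerRing

/-- **Euler's identity in `P`**: `6 · ⟦Z₂⟧ = ⟦π⟧ · ⟦π⟧`. [Kontsevich–Zagier 2001, §1.2] -/
theorem soloInformed_six_mul_toFormalPeriod_zetaTwoRep :
    (6 : FormalPeriodRing) * toFormalPeriod (of soloInformedZetaTwoRep) =
      toFormalPeriod (of piRep) * toFormalPeriod (of piRep) := by
  have h : toFormalPeriod (6 • of soloInformedZetaTwoRep) = toFormalPeriod (of piRep * of piRep) :=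
    toFormalPeriod_eq_iff.2 soloInformed_six_zetaTwo_sub_pi_mul_pi_mem_relations
  rw [map_nsmul, map_mul, nsmul_eq_mul] at h
  simpa using h

/-- **`⟦Z₂⟧ = ⟦[(0,1)², 1/(1−xy)]⟧` lies in the Baker ring**: `⟦Z₂⟧ = ρ(1/6) · ⟦π⟧²`.
[Kontsevich–Zagier 2001, §1.2; this work] -/
theorem soloInformed_zetaTwoRep_mem_bakerRing :
    toFormalPeriod (of soloInformedZetaTwoRep) ∈ soloInformedBakerRing := by
  set z := toFormalPeriod (of soloInformedZetaTwoRep) with hz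
  have hk : (6 : algebraicClosure ℚ ℝ) ≠ 0 := by
    intro h
    have h' := congrArg (fun k : algebraicClosure ℚ ℝ => (k : ℝ)) h
    norm_num at h'
  have e : z = soloInformedPtHom ((6 : algebraicClosure ℚ ℝ)⁻¹) *
      (toFormalPeriod (of piRep) * toFormalPeriod (of piRep)) := by
    rw [← soloInformed_six_mul_toFormalPeriod_zetaTwoRep, ← mul_assoc,
      ← map_ofNat soloInformedPtHom 6, ← map_mul, inv_mul_cancel₀ hk, map_one, one_mul]
  rw [e]
  exact mul_mem (soloInformed_bakerGroup_le_bakerRing (soloInformed_ptHom_mem_bakerGroup _))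
    (mul_mem soloInformed_piRep_mem_bakerRing soloInformed_piRep_mem_bakerRing)

/-- `⟦[(0,1)², 6/(1−xy)]⟧ = 6 · ⟦Z₂⟧` lies in the Baker ring. -/
theorem soloInformed_sixZetaTwoRep_mem_bakerRing :
    toFormalPeriod (of soloInformedSixZetaTwoRep) ∈ soloInformedBakerRing := by
  have h : toFormalPeriod (of soloInformedSixZetaTwoRep) =
      6 • toFormalPeriod (of soloInformedZetaTwoRep) := by
    rw [← map_nsmul, toFormalPeriod_eq_iff]
    exact IntegralRep.of_constMul_nat_sub_nsmul_mem_relations _ 6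
  rw [h]
  exact nsmul_mem soloInformed_zetaTwoRep_mem_bakerRing 6

/-! ### Consequences under `AlgIndepLogarithms` -/

/-- **The period conjecture for `ζ(2)` against the Baker ring** (under `AlgIndepLogarithms`): a
formal combination whose class lies in the Baker ring and whose value is `π²/6` is congruent to
Beukers' integral `[(0,1)², 1/(1−xy)]` modulo the four moves. [this work] -/
theorem soloInformed_sub_zetaTwoRep_mem_relations_of_mem_bakerRing (hAIL : AlgIndepLogarithms)
    {c : FormalRep} (hc : toFormalPeriod c ∈ soloInformedBakerRing)
    (h : eval c = Real.pi ^ 2 / 6) : c - of soloInformedZetaTwoRep ∈ relations :=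
  soloInformed_sub_mem_relations_of_mem_bakerRing hAIL hc soloInformed_zetaTwoRep_mem_bakerRing
    (by rw [h, eval_of, soloInformed_zetaTwoRep_value])

/-- **Products of one-variable rational integrals with value `ζ(2)`** (under `AlgIndepLogarithms`):
if `∫∫_{D₁×D₂} f(x) g(y) dx dy = π²/6` with `f, g` rational over `ℚ` (dimensions `≤ 1`), then
`[D₁ × D₂, f ⊗ g]` is `KZ.Equivalent` to `[(0,1)², 1/(1−xy)]`. [this work] -/
theorem soloInformed_equivalent_prod_zetaTwoRep_of_isRational (hAIL : AlgIndepLogarithms)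
    {n m : ℕ} (hn : n ≤ 1) (hm : m ≤ 1) {r : IntegralRep n} {s : IntegralRep m}
    (hr : r.IsRational) (hs : s.IsRational) (h : (r.prod s).value = Real.pi ^ 2 / 6) :
    Equivalent (r.prod s) soloInformedZetaTwoRep :=
  soloInformed_sub_zetaTwoRep_mem_relations_of_mem_bakerRing hAIL
    (soloInformed_prod_mem_bakerRing (soloInformed_mem_bakerRing_of_isRational hn r hr)
      (soloInformed_mem_bakerRing_of_isRational hm s hs))
    (by rw [eval_of, h])

/-- **The value `π` against the Baker ring** (under `AlgIndepLogarithms`): a formal combination with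
class in the Baker ring (any weight) and value `π` is congruent to the disc. [this work] -/
theorem soloInformed_sub_piRep_mem_relations_of_mem_bakerRing (hAIL : AlgIndepLogarithms)
    {c : FormalRep} (hc : toFormalPeriod c ∈ soloInformedBakerRing) (h : eval c = Real.pi) :
    c - of piRep ∈ relations :=
  soloInformed_sub_mem_relations_of_mem_bakerRing hAIL hc soloInformed_piRep_mem_bakerRing
    (by rw [h, eval_of, piRep_value])

end Summit.KontsevichZagierPeriods.KontsevichZagierPeriods.Theorems
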